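import Literature.NumberTheory.Irrationality.KrattenthalerRivoal2007.PropositionSixInner
import Literature.NumberTheory.Irrationality.KrattenthalerRivoal2007.SpecialBricks
import HarnessLib

/-!
# Proposition 6, top level: the outermost two pairs in Krattenthaler–Rivoal's form, and the special bricks

[KrattenthalerRivoal2007, §12, (eq:briques)], top line:
`R(0,n+1;−ε)·(−ε) · ∏_{q=0}^{r−1} R(n,0;nq+ε+1) · R(n−i,0;rn+i+ε+2) · R₁(n,i,i;ε) · R₂(n,i',i;ε)` with
`i = i_{A/2+B}`, `i' = i_{A/2+B−1}`. In the tree's normal form (`sPolThree`, `theoreme9_corThreeParams`) the top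
balanced `₄F₃` appears as `W(ε−n+k, −ε−n, rn+k+2; ε+1−U, 1−ε−U; U)` (`U = n−k`); KR's term structure is the Sears
transform of this `W` fixing the parameter `rn+k+2`:
`W(rn+k+2, rn+k+1+ε, rn+1−ε; rn+k+2−ε, rn+k+2+ε; U)` (`balFourFThree_KR`), whose `u`-th term (with `i = k+u`)
has exactly KR's windows. This file proves
* `sPolThree_eq_KR` — `sPolThree` with the top `₄F₃` in KR's form;
* **`top_brick_identity`** — for `r ≥ 1`, `k+u ≤ n`:
  `(1−ε)_{rn} (1+ε)_{rn}² · topRaw(k,u) = (−1)^{k+n−k−u} n!^{3r} n! (1−ε)_n (1+ε)_n · R₂(n,k,i;ε) · ∏_q R(n,0;nq+ε+1)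
   · R₁(n,i,i;ε) · R(n−i,0;rn+i+ε+2)`, where `topRaw(k,u) = C(n,k)(ε−n)_k(rn+ε+1)_k k! · [u-th term of the KR ₄F₃]`
  (tree: `specialBrickR2`, `pbBlockPlus n r 1`, `specialBrickR1`, `polyBrick (rn+i+2) (n−i)`); all five bricks are
  `IsDInt (d_n)` at `0` by Lemmes 9–10 (`SpecialBricks.lean`, `EpsilonBricks.lean`);
* the ASSEMBLY: `gKR` (= `K·S(ε)/ε` in the tree's normalisation), `brickTerm`, `brickTerm_isDInt`,
  **`gKR_eq_sum_brickTerm`** (near `0`, `gKR = ± Σ_k Σ_u brickTerm(k,u)` — (eq:briques) in full, from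
  `sPolThree_eq_KR`, `rawInner_dictionary`, `inner_eq_flat`, `topRaw_sum`, `top_brick_identity`) and
  **`proposition6_evenA`**: `IsDInt (d_n) N (gKR n M (b+1) r) 0` for all `N` — Proposition 6 for `A = 2M+2`,
  `B = b+2 ≥ 2`, `r ≥ 1`; `brickTermOne`, `gKR_zero_eq_sum_brickTermOne`, **`proposition6_evenA_one`** (`B = 1`: the
  block brick `∏_q R(n,0;qn+ε+1)` cancels and `R(0,n+1;−ε)(−ε)` appears squared) and **`proposition6_even`**: every even
  `A ≥ 2`, every `B ≥ 1`, `r ≥ 1`; **`r = 0`** (appended): the top line degenerates (`(−rn)_{U−u} = (0)_{U−u}`),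
  `topRaw_zero_r_top`, `gKR_zero_r_eq_sum` / `gKR_zero_r_one_eq_sum`, **`proposition6_even_zero_r`** and
  **`proposition6_even'`**: every even `A ≥ 2`, every `B ≥ 1`, every `r ≥ 0` (odd `A` via the confluent chain: TODO).

## References
* [KrattenthalerRivoal2007] §12 proof of Prop. 6, (eq:briques); §11 Lemme 10 (arXiv:math/0311114 pp. 24–25, 29).
-/

open Finset Filter
open scoped Nat
open Literature.NumberTheory.Transcendental
open Literature.Combinatorics.Enumerative.BaileyChain
open Literature.Combinatorics.Enumerative (balFourFThree balFourFThree_sears)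

namespace Literature.NumberTheory.Irrationality.KrattenthalerRivoal2007

/-! ### Rising factorials (private shorthand) -/

/-- `(z)_m` (private shorthand). [folklore] -/
private def pw (z : ℚ) (m : ℕ) : ℚ := ∏ i ∈ range m, (z + i)

/-- Unfolding. [folklore] -/
private theorem pw_def (z : ℚ) (m : ℕ) : pw z m = ∏ i ∈ range m, (z + i) := rfl

/-- `(z)_{m₁+m₂} = (z)_{m₁}(z+m₁)_{m₂}`. [folklore] -/
private theorem pw_add (z : ℚ) (m₁ m₂ : ℕ) : pw z (m₁ + m₂) = pw z m₁ * pw (z + m₁) m₂ := by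
  simp only [pw, prod_range_add]
  congr 1
  refine prod_congr rfl fun i _ => ?_
  push_cast
  ring

/-- Congruence. [folklore] -/
private theorem pw_congr {z z' : ℚ} (h : z = z') (m : ℕ) : pw z m = pw z' m := by rw [h]

/-- `(z)_{m+1} = (z)_m (z+m)`. [folklore] -/
private theorem pw_succ (z : ℚ) (m : ℕ) : pw z (m + 1) = pw z m * (z + m) := by
  simp [pw, prod_range_succ]

/-- `(z)_{m+1} = z (z+1)_m`. [folklore] -/
private theorem pw_succ_left (z : ℚ) (m : ℕ) : pw z (m + 1) = z * pw (z + 1) m := by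
  induction m with
  | zero => simp [pw]
  | succ m ih =>
    rw [pw_succ, ih, pw_succ]
    push_cast
    ring

/-- Reflection `(−z)_m = (−1)^m (z−m+1)_m`. [folklore] -/
private theorem pw_neg_rev (z : ℚ) (m : ℕ) : pw (-z) m = (-1) ^ m * pw (z - m + 1) m := by
  induction m with
  | zero => simp [pw]
  | succ m ih =>
    rw [pw_succ, ih, pw_succ_left,
      pw_congr (show z - ((m + 1 : ℕ) : ℚ) + 1 + 1 = z - (m : ℕ) + 1 by push_cast; ring) m]
    push_cast
    ring

/-- `∏_{f ∈ (a, a+m]} (f + t) = (a+1+t)_m`. [folklore] -/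
private theorem prod_Ioc_add_eq_pw (a m : ℕ) (t : ℚ) : ∏ f ∈ Ioc a (a + m), ((f : ℚ) + t) = pw ((a : ℚ) + 1 + t) m := by
  induction m with
  | zero => simp [pw]
  | succ m ih =>
    rw [← Nat.add_assoc, prod_Ioc_succ_top (Nat.le_add_right a m), ih, pw_succ]
    push_cast
    ring

/-- `∏_{f ∈ (a, a+m]} (f − t) = (a+1−t)_m`. [folklore] -/
private theorem prod_Ioc_sub_eq_pw (a m : ℕ) (t : ℚ) : ∏ f ∈ Ioc a (a + m), ((f : ℚ) - t) = pw ((a : ℚ) + 1 - t) m := by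
  induction m with
  | zero => simp [pw]
  | succ m ih =>
    rw [← Nat.add_assoc, prod_Ioc_succ_top (Nat.le_add_right a m), ih, pw_succ]
    push_cast
    ring

/-- `(−N)_m = (−1)^m N!/(N−m)!` for `m ≤ N`. [folklore] -/
private theorem pw_neg_nat_mul_factorial {N m : ℕ} (h : m ≤ N) :
    pw (-(N : ℚ)) m * ((N - m)! : ℚ) = (-1) ^ m * (N ! : ℚ) := by
  have h1 : pw (-(N : ℚ)) m = (-1) ^ m * (N.descFactorial m : ℚ) := by
    induction m with
    | zero => simp [pw]
    | succ m ih =>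
      rw [pw_succ, ih (Nat.le_of_succ_le h), Nat.descFactorial_succ, pow_succ]
      push_cast [Nat.cast_sub (Nat.le_of_succ_le h)]
      ring
  rw [h1, mul_assoc]
  congr 1
  exact_mod_cast (by rw [mul_comm]; exact Nat.factorial_mul_descFactorial h : N.descFactorial m * (N - m)! = N !)

/-! ### The top `₄F₃` in Krattenthaler–Rivoal's form -/

/-- `W` is symmetric in its three numerator parameters (`x ↔ z`). [cite: KrattenthalerRivoal2007, §6 (4F3)] -/
theorem balFourFThree_swap13 (x y z e f : ℚ) (m : ℕ) : balFourFThree x y z e f m = balFourFThree z y x e f m := by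
  unfold balFourFThree
  refine sum_congr rfl fun u _ => ?_
  rw [show e + f - z - y - x = e + f - x - y - z by ring]
  ring

/-- KR's top balanced `₄F₃` (polynomial form): `W(rn+k+2, rn+k+1+ε, rn+1−ε; rn+k+2−ε, rn+k+2+ε; n−k)` — the
`₄F₃[−U, rn+ε+1+k, rn+2+k, rn+1−ε; rn+ε+2+k, (r−1)n+1+k, rn+2−ε+k]` of the printed right-hand side of (eq:main) at the
parameters of Corollaire 3, i.e. the Sears transform (fixing `rn+k+2`) of the tree's `W(ε−n+k, −ε−n, rn+k+2; ε+1−U, 1−ε−U; U)`.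
[cite: KrattenthalerRivoal2007, §6 Théorème 9 (right-hand side) at §10 proof of Corollaire 3] -/
def balFourFThreeKR (ε : ℚ) (n r k : ℕ) : ℚ :=
  balFourFThree (((r * n : ℕ) : ℚ) + k + 2) (((r * n : ℕ) : ℚ) + k + 1 + ε) (((r * n : ℕ) : ℚ) + 1 - ε)
    (((r * n : ℕ) : ℚ) + k + 2 - ε) (((r * n : ℕ) : ℚ) + k + 2 + ε) (n - k)

/-- The tree's top `W` equals KR's (`balFourFThree_swap13` + `balFourFThree_sears`).
[cite: KrattenthalerRivoal2007, §6 proof of Théorème 9 ((Whipple), (4F3))] -/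
theorem balFourFThree_top_eq_KR (ε : ℚ) (n r k : ℕ) (hk : k ≤ n) :
    balFourFThree (ε - n + k) (-ε - n) (((r * n : ℕ) : ℚ) + k + 2) (ε + 1 - ((n - k : ℕ) : ℚ))
        (1 - ε - ((n - k : ℕ) : ℚ)) (n - k) = balFourFThreeKR ε n r k := by
  rw [balFourFThree_swap13, balFourFThree_sears, balFourFThreeKR]
  have hU : ((n - k : ℕ) : ℚ) = (n : ℚ) - k := Nat.cast_sub hk
  congr 1
  · rw [hU]; ring
  · rw [hU]; ring
  · rw [hU]; ring
  · rw [hU]; ring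

/-- **`sPolThree` with the top `₄F₃` in KR's form.** [cite: KrattenthalerRivoal2007, §12 proof of Prop. 6; §6 Théorème 9] -/
theorem sPolThree_eq_KR (ε : ℚ) (n M B' r : ℕ) :
    sPolThree ε n M B' r = ∑ k ∈ range (n + 1), (n.choose k : ℚ) * (∏ j ∈ range k, (ε - n + j)) *
      (∏ j ∈ range k, (((r * n : ℕ) : ℚ) + ε + 1 + j)) * rawInner n r M B' k ε * balFourFThreeKR ε n r k := by
  rw [sPolThree_eq_sum_rawInner]
  refine sum_congr rfl fun k hk => ?_
  rw [balFourFThree_top_eq_KR ε n r k (Nat.lt_succ_iff.mp (mem_range.mp hk))]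

/-! ### The top term and its bricks -/

/-- The raw top term of index `(k, u)` (`i = k+u ≤ n`): `C(n,k) (ε−n)_k (rn+ε+1)_k · k! ·` [`u`-th term of
`balFourFThreeKR`], i.e. `C(n,k)(ε−n)_k(rn+ε+1)_k k! · C(U,u) (rn+k+2)_u (rn+k+1+ε)_u (rn+1−ε)_u (−rn)_{U−u}
(rn+k+2−ε+u)_{U−u} (rn+k+2+ε+u)_{U−u}` (`U = n−k`; the `k!` is the one of `inner_eq_flat`).
[cite: KrattenthalerRivoal2007, §12 (eq:briques), top line] -/
def topRaw (n r k u : ℕ) (ε : ℚ) : ℚ :=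
  (n.choose k : ℚ) * (∏ j ∈ range k, (ε - n + j)) * (∏ j ∈ range k, (((r * n : ℕ) : ℚ) + ε + 1 + j)) * (k ! : ℚ) *
    (((n - k).choose u : ℚ) * (∏ j ∈ range u, (((r * n : ℕ) : ℚ) + k + 2 + j)) *
      (∏ j ∈ range u, (((r * n : ℕ) : ℚ) + k + 1 + ε + j)) * (∏ j ∈ range u, (((r * n : ℕ) : ℚ) + 1 - ε + j)) *
      (∏ j ∈ range (n - k - u), (-((r * n : ℕ) : ℚ) + j)) *
      (∏ j ∈ range (n - k - u), (((r * n : ℕ) : ℚ) + k + 2 - ε + u + j)) *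
      ∏ j ∈ range (n - k - u), (((r * n : ℕ) : ℚ) + k + 2 + ε + u + j))

/-- `balFourFThreeKR` is the sum of the `u`-parts of `topRaw`. [cite: KrattenthalerRivoal2007, §12 (eq:briques)] -/
theorem topRaw_sum (n r k : ℕ) (ε : ℚ) :
    ∑ u ∈ range (n - k + 1), topRaw n r k u ε =
      (n.choose k : ℚ) * (∏ j ∈ range k, (ε - n + j)) * (∏ j ∈ range k, (((r * n : ℕ) : ℚ) + ε + 1 + j)) * (k ! : ℚ) *
        balFourFThreeKR ε n r k := by
  rw [balFourFThreeKR, balFourFThree, mul_sum]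
  refine sum_congr rfl fun u _ => ?_
  unfold topRaw
  have e : (((r * n : ℕ) : ℚ) + k + 2 - ε) + (((r * n : ℕ) : ℚ) + k + 2 + ε) - (((r * n : ℕ) : ℚ) + k + 2) -
      (((r * n : ℕ) : ℚ) + k + 1 + ε) - (((r * n : ℕ) : ℚ) + 1 - ε) = -((r * n : ℕ) : ℚ) := by ring
  rw [e]

/-- **The top-level brick identity** of (eq:briques): for `r ≥ 1` and `k + u ≤ n` (`i = k+u`, `U = n−k`),
`(1−ε)_{rn} ((1+ε)_{rn})² · topRaw(k,u) = (−1)^{k+(n−k−u)} n!^{3r} n! (1−ε)_n (1+ε)_n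
   · R₂(n,k,i;ε) · ∏_{q<r} R(n,0;qn+1+ε) · R₁(n,i,i;ε) · R(n−i,0;rn+i+ε+2)`
(tree: `specialBrickR2 n r k i`, `pbBlockPlus n r 1`, `specialBrickR1 n r i i`, `polyBrick (rn+i+2) (n−i)`). With the
normaliser `(1−ε)_{rn}(1+ε)_{rn}²/(n!^{3r}(1−ε)_n²(1+ε)_n)` of the assembly this is
`± R(0,n+1;−ε)(−ε) · R₂ · ∏_q R(n,0;…) · R₁ · R(n−i,0;…)` — KR's top line, every factor `d_n`-integral to all orders.
[cite: KrattenthalerRivoal2007, §12 proof of Proposition 6, (eq:briques) (top line); §11 Lemme 10] -/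
theorem top_brick_identity (n r k u : ℕ) (hr : 1 ≤ r) (hku : k + u ≤ n) (ε : ℚ) :
    (∏ l ∈ range (r * n), (1 - ε + (l : ℚ))) * (∏ l ∈ range (r * n), (1 + ε + (l : ℚ))) ^ 2 * topRaw n r k u ε =
      (-1) ^ (k + (n - k - u)) * (n ! : ℚ) ^ (3 * r) * (n ! : ℚ) *
        (∏ l ∈ range n, (1 - ε + (l : ℚ))) * (∏ l ∈ range n, (1 + ε + (l : ℚ))) *
        specialBrickR2 n r k (k + u) ε * pbBlockPlus n r 1 ε * specialBrickR1 n r (k + u) (k + u) ε *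
        polyBrick (((r * n + (k + u) + 2 : ℕ) : ℤ)) (n - k - u) ε := by
  -- integer bookkeeping
  have hkn : k ≤ n := by omega
  have hrn : n ≤ r * n := Nat.le_mul_of_pos_left n hr
  have hr1 : (r - 1) * n = r * n - n := Nat.sub_one_mul r n
  have hF : r * n - (n - k - u) = (r - 1) * n + (k + u) := by rw [hr1]; omega
  -- blocks: `pbBlockPlus n r 1 ε * n!^r = (1+ε)_{rn}`
  have hblocks : ∀ (z : ℚ) (r' : ℕ), pw z (r' * n) = ∏ q ∈ range r', pw (z + q * n) n := by
    intro z r'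
    induction r' with
    | zero => simp [pw]
    | succ r' ih =>
      rw [Nat.succ_mul, pw_add, ih, prod_range_succ]
      congr 1
      exact pw_congr (by push_cast; ring) n
  have hpbB : pbBlockPlus n r 1 ε * (n ! : ℚ) ^ r = ∏ l ∈ range (r * n), (1 + ε + (l : ℚ)) := by
    unfold pbBlockPlus polyBrick
    rw [prod_div_distrib, prod_const, card_range, div_mul_cancel₀ _ (by positivity), ← pw_def, hblocks]
    refine prod_congr rfl fun q _ => ?_
    rw [← pw_def]
    exact pw_congr (by push_cast; ring) _
  -- atoms
  unfold topRaw
  set v := n - k - u with hv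
  set X := ∏ j ∈ range k, (ε - n + (j : ℚ)) with hX
  set Yk := ∏ j ∈ range k, (((r * n : ℕ) : ℚ) + ε + 1 + j) with hYk
  set A1 := ∏ j ∈ range u, (((r * n : ℕ) : ℚ) + k + 2 + j) with hA1
  set A2 := ∏ j ∈ range u, (((r * n : ℕ) : ℚ) + k + 1 + ε + j) with hA2
  set A3 := ∏ j ∈ range u, (((r * n : ℕ) : ℚ) + 1 - ε + j) with hA3
  set A4 := ∏ j ∈ range v, (-((r * n : ℕ) : ℚ) + j) with hA4
  set A5 := ∏ j ∈ range v, (((r * n : ℕ) : ℚ) + k + 2 - ε + u + j) with hA5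
  set A6 := ∏ j ∈ range v, (((r * n : ℕ) : ℚ) + k + 2 + ε + u + j) with hA6
  set Rm := ∏ l ∈ range (r * n), (1 - ε + (l : ℚ)) with hRm
  set Rp := ∏ l ∈ range (r * n), (1 + ε + (l : ℚ)) with hRp
  set Dm := ∏ l ∈ range n, (1 - ε + (l : ℚ)) with hDm
  set Dp := ∏ l ∈ range n, (1 + ε + (l : ℚ)) with hDp
  set PU := pw (1 - ε) (n - k) with hPU
  set Pk := pw (((n - k : ℕ) : ℚ) + 1 - ε) k with hPk
  set W2a := pw (((n - k : ℕ) : ℚ) + 1 - ε) (r * n + u - (n - k)) with hW2a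
  set W1 := pw ((n : ℚ) + 1 + ε) (r * n + (k + u) - n) with hW1
  set F := (((r - 1) * n + (k + u))! : ℚ) with hFdef
  set Cb := (((r * n + (k + u) + 1).choose u : ℕ) : ℚ) with hCb
  have hU : ((n - k : ℕ) : ℚ) = (n : ℚ) - k := Nat.cast_sub hkn
  -- window identities
  have cX : X = (-1) ^ k * Pk := by
    rw [hX, ← pw_def, pw_congr (show ε - (n : ℚ) = -((n : ℚ) - ε) by ring) k, pw_neg_rev, hPk]
    congr 1
    exact pw_congr (by rw [hU]; ring) k
  have cDm : Dm = PU * Pk := by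
    rw [hDm, ← pw_def, hPU, hPk]
    conv_lhs => rw [show n = (n - k) + k by omega]
    rw [pw_add]
    congr 1
    exact pw_congr (by rw [hU]; ring) k
  have cRm : Rm * A3 = PU * W2a := by
    rw [hRm, hA3, ← pw_def, ← pw_def, hPU, hW2a]
    have h1 : pw (1 - ε) (r * n + u) = pw (1 - ε) (r * n) * pw (((r * n : ℕ) : ℚ) + 1 - ε) u := by
      rw [pw_add]; congr 1; exact pw_congr (by push_cast; ring) u
    have h2 : pw (1 - ε) ((n - k) + (r * n + u - (n - k))) = pw (1 - ε) (n - k) * pw (((n - k : ℕ) : ℚ) + 1 - ε) (r * n + u - (n - k)) := by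
      rw [pw_add]; congr 1; exact pw_congr (by ring) _
    rw [← h1, ← h2, show (n - k) + (r * n + u - (n - k)) = r * n + u by omega]
  have cA5 : A5 = pw (((r * n + (k + u) + 1 : ℕ) : ℚ) + 1 - ε) v := by
    rw [hA5, ← pw_def]; exact pw_congr (by push_cast; ring) v
  have cYA : Yk * A2 = pw (((r * n : ℕ) : ℚ) + 1 + ε) (k + u) := by
    rw [hYk, hA2, ← pw_def, ← pw_def, pw_add]
    congr 1
    · exact pw_congr (by ring) k
    · exact pw_congr (by ring) u
  have cRp1 : Rp * pw (((r * n : ℕ) : ℚ) + 1 + ε) (k + u) = Dp * W1 := by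
    rw [hRp, hDp, ← pw_def, ← pw_def, hW1]
    have h1 : pw (1 + ε) (r * n + (k + u)) = pw (1 + ε) (r * n) * pw (((r * n : ℕ) : ℚ) + 1 + ε) (k + u) := by
      rw [pw_add]; congr 1; exact pw_congr (by push_cast; ring) _
    have h2 : pw (1 + ε) (n + (r * n + (k + u) - n)) = pw (1 + ε) n * pw ((n : ℚ) + 1 + ε) (r * n + (k + u) - n) := by
      rw [pw_add]; congr 1; exact pw_congr (by ring) _
    rw [← h1, ← h2, show n + (r * n + (k + u) - n) = r * n + (k + u) by omega]
  -- the bricks, multiplied out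
  have hR2 : specialBrickR2 n r k (k + u) ε * (n ! : ℚ) ^ r = Cb * (W2a * A5) := by
    unfold specialBrickR2
    rw [show r * n + (k + u) - k = (n - k) + (r * n + u - (n - k)) by omega, prod_Ioc_sub_eq_pw,
      show (r + 1) * n + 1 = (r * n + (k + u) + 1) + v by rw [Nat.add_mul, one_mul]; omega,
      prod_Ioc_sub_eq_pw, ← hW2a, ← cA5, hCb, show k + u - k = u by omega]
    field_simp
  have hR1 : specialBrickR1 n r (k + u) (k + u) ε * ((n ! : ℚ) ^ r * F) = ((r * n)! : ℚ) * W1 := by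
    unfold specialBrickR1
    rw [show n + (k + u) - (k + u) = n by omega, show r * n + (k + u) = n + (r * n + (k + u) - n) by omega,
      prod_Ioc_add_eq_pw, ← hW1, hFdef]
    have hF0 : (((r - 1) * n + (k + u))! : ℚ) ≠ 0 := by positivity
    field_simp
  have hPB : polyBrick (((r * n + (k + u) + 2 : ℕ) : ℤ)) v ε * (v ! : ℚ) = A6 := by
    unfold polyBrick
    rw [div_mul_cancel₀ _ (by positivity), hA6]
    exact prod_congr rfl fun l _ => by push_cast; ring
  -- constants
  have cA1 : A1 = Cb * (u ! : ℚ) := by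
    have h1 : ((r * n + k + 1)! : ℚ) * A1 = ((r * n + (k + u) + 1)! : ℚ) := by
      have := Nat.factorial_mul_ascFactorial (r * n + k + 1) u
      rw [Nat.ascFactorial_eq_prod_range, show r * n + k + 1 + u = r * n + (k + u) + 1 by ring] at this
      rw [hA1]
      have h' := congrArg (Nat.cast : ℕ → ℚ) this
      push_cast at h'
      rw [← h']
      congr 1
      exact prod_congr rfl fun j _ => by push_cast; ring
    have h2 : Cb * (u ! : ℚ) * ((r * n + k + 1)! : ℚ) = ((r * n + (k + u) + 1)! : ℚ) := by
      rw [hCb]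
      have := Nat.choose_mul_factorial_mul_factorial (show u ≤ r * n + (k + u) + 1 by omega)
      rw [show r * n + (k + u) + 1 - u = r * n + k + 1 by omega] at this
      exact_mod_cast this
    have hne : ((r * n + k + 1)! : ℚ) ≠ 0 := by positivity
    apply mul_left_cancel₀ hne
    linear_combination h1 - h2
  have cA4 : A4 * F = (-1) ^ v * ((r * n)! : ℚ) := by
    rw [hA4, ← pw_def, hFdef, ← hF]
    exact pw_neg_nat_mul_factorial (by omega)
  have cC : ((n.choose k : ℕ) : ℚ) * (k ! : ℚ) * (((n - k).choose u : ℕ) : ℚ) * (u ! : ℚ) * (v ! : ℚ) = (n ! : ℚ) := by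
    have h1 : ((n.choose k : ℕ) : ℚ) * (k ! : ℚ) * ((n - k)! : ℚ) = (n ! : ℚ) := by
      exact_mod_cast Nat.choose_mul_factorial_mul_factorial hkn
    have h2 : (((n - k).choose u : ℕ) : ℚ) * (u ! : ℚ) * (v ! : ℚ) = ((n - k)! : ℚ) := by
      rw [hv]; exact_mod_cast Nat.choose_mul_factorial_mul_factorial (show u ≤ n - k by omega)
    rw [← h1, ← h2]; ring
  -- assemble (clear the constant denominators by multiplying through)
  have hden : ((n ! : ℚ) ^ r) ^ 3 * F * (v ! : ℚ) ≠ 0 := by rw [hFdef]; positivity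
  apply mul_right_cancel₀ hden
  have eL : Rm * Rp ^ 2 * (((n.choose k : ℕ) : ℚ) * X * Yk * (k ! : ℚ) *
        ((((n - k).choose u : ℕ) : ℚ) * A1 * A2 * A3 * A4 * A5 * A6)) * (((n ! : ℚ) ^ r) ^ 3 * F * (v ! : ℚ)) =
      (Rm * A3) * (Rp * (Yk * A2)) * Rp * X * A1 * (A4 * F) * A5 * A6 *
        (((n.choose k : ℕ) : ℚ) * (k ! : ℚ) * (((n - k).choose u : ℕ) : ℚ)) * ((n ! : ℚ) ^ r) ^ 3 * (v ! : ℚ) := by ring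
  have eR : (-1) ^ (k + (n - k - u)) * (n ! : ℚ) ^ (3 * r) * (n ! : ℚ) * Dm * Dp *
        specialBrickR2 n r k (k + u) ε * pbBlockPlus n r 1 ε * specialBrickR1 n r (k + u) (k + u) ε *
        polyBrick (((r * n + (k + u) + 2 : ℕ) : ℤ)) (n - k - u) ε * (((n ! : ℚ) ^ r) ^ 3 * F * (v ! : ℚ)) =
      (-1) ^ (k + v) * (n ! : ℚ) ^ (3 * r) * (n ! : ℚ) * Dm * Dp *
        (specialBrickR2 n r k (k + u) ε * (n ! : ℚ) ^ r) * (pbBlockPlus n r 1 ε * (n ! : ℚ) ^ r) *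
        (specialBrickR1 n r (k + u) (k + u) ε * ((n ! : ℚ) ^ r * F)) *
        (polyBrick (((r * n + (k + u) + 2 : ℕ) : ℤ)) v ε * (v ! : ℚ)) := by rw [← hv]; ring
  rw [eL, eR, cRm, cYA, cRp1, cX, cA1, hR2, hpbB, hR1, hPB, cDm, pow_add]
  linear_combination PU * W2a * Dp * W1 * Rp * Pk * Cb * A5 * A6 * (-1) ^ k * ((n ! : ℚ) ^ r) ^ 3 *
    ((((n.choose k : ℕ) : ℚ) * (k ! : ℚ) * (((n - k).choose u : ℕ) : ℚ) * (u ! : ℚ) * (v ! : ℚ)) * cA4 +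
      (-1) ^ v * ((r * n)! : ℚ) * cC)

/-! ### Assembly: Proposition 6 for `A = 2M+2`, `B = B'+1 ≥ 2`, `r ≥ 1`

Summing `PartialFractionTaylor.regR_dictionary` over `j` and using `wpTaylorSum_even_eq_eps_mul`:
`Σ_j ((−1)^A)^j regR_j(ε) = ε · gKR(ε)` near `ε = 0`, with `gKR` below (`A = 2M+2`, `B = B'+1`); KR's Proposition 6
(`d_n^{h−1} 𝒟_h(K S)(0) ∈ ℤ`) is thus `IsDInt (d_n) N gKR 0` for all `N`. We prove it for `B' ≥ 1`, `r ≥ 1` by writing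
`gKR` near `0` as `±Σ_k Σ_u brickTerm(k,u)`, each `brickTerm` a signed product of KR's bricks (both lines of (eq:briques)). -/

/-- `gKR = K·S(ε)/ε` in the tree's normalisation (`A = 2M+2`, `B = B'+1`):
`((−1)^{rn})^B (−1)^{nB'} · n!^{A−1} ((1−ε)_{rn}(1+ε)_{rn})^B / (((1−ε)_n(1+ε)_n)^{A+B} n!^{2Br}) · sPolThree`.
[cite: KrattenthalerRivoal2007, §12 proof of Proposition 6 («S(ε) = ε·(…)»); §10 Corollaire 3] -/
def gKR (n M B' r : ℕ) (ε : ℚ) : ℚ :=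
  ((-1 : ℚ) ^ (r * n)) ^ (B' + 1) * (-1) ^ (n * B') *
    ((n ! : ℚ) ^ (2 * M + 1) *
      ((∏ l ∈ range (r * n), (1 - ε + (l : ℚ))) * ∏ l ∈ range (r * n), (1 + ε + (l : ℚ))) ^ (B' + 1) /
      ((((∏ l ∈ range n, (1 - ε + (l : ℚ))) * ∏ l ∈ range n, (1 + ε + (l : ℚ))) ^ (2 * M + 2 + (B' + 1))) *
        (n ! : ℚ) ^ (2 * (B' + 1) * r))) *
    sPolThree ε n M B' r

/-- The `(k,u)` summand of (eq:briques): `(−1)^{k+n−k−u} · R(0,n+1;−ε)(−ε) · innerFlat(k) · R₂(n,k,i;ε) · ∏_q R(n,0;qn+ε+1)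
· R₁(n,i,i;ε) · R(n−i,0;rn+i+ε+2)` (`i = k+u`). [cite: KrattenthalerRivoal2007, §12 proof of Proposition 6, (eq:briques)] -/
def brickTerm (n r M B' k u : ℕ) (ε : ℚ) : ℚ :=
  (-1) ^ (k + (n - k - u)) * rbMinus n ε * innerFlat n r M B' k ε *
    (specialBrickR2 n r k (k + u) ε * pbBlockPlus n r 1 ε * specialBrickR1 n r (k + u) (k + u) ε *
      polyBrick (((r * n + (k + u) + 2 : ℕ) : ℤ)) (n - k - u) ε)

/-- Every `brickTerm` is `d_n`-integral to all orders at `ε = 0` (Lemmes 9, 10 and `innerFlat_isDInt`).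
[cite: KrattenthalerRivoal2007, §12 proof of Proposition 6 ((eq:briques) ⇒ (eq:6)); §11 Lemmes 9–10] -/
theorem brickTerm_isDInt {n r : ℕ} (hr : 1 ≤ r) (M B' : ℕ) {k u : ℕ} (hku : k + u ≤ n) (N : ℕ) :
    IsDInt (Nat.lcmUpto n) N (brickTerm n r M B' k u) 0 := by
  have h1 := IsDInt.const (Nat.lcmUpto n) N ((-1) ^ (k + (n - k - u))) 0
  have h2 := rbMinus_isDInt (n := n) (i := n) le_rfl N
  have h3 := innerFlat_isDInt (n := n) (r := r) N M B' k (by omega)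
  have h4 := specialBrickR2_isDInt n r k (k + u) hr (by omega) hku N
  have h5 := pbBlockPlus_isDInt (n := n) (r := r) 1 N
  have h6 := specialBrickR1_isDInt n r (k + u) (k + u) hr hku N
  have h7 := polyBrick_eps_isDInt (((r * n + (k + u) + 2 : ℕ) : ℤ)) (show n - k - u ≤ n by omega) N
  exact (((h1.mul h2).mul h3).mul (((h4.mul h5).mul h6).mul h7)).congr
    (Eventually.of_forall fun ε => by simp only [brickTerm]; push_cast; ring)

/-- The normalisers collapse: (prefactor of `gKR`) · (dictionary factor `D_X/E_X`-part) · (top-line factor) = `n!/(1−ε)_n`.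
[cite: KrattenthalerRivoal2007, §12 proof of Proposition 6, (eq:briques)] -/
private theorem assembly_scalar (n r M b : ℕ) {Rm Rp Dm Dp : ℚ} (hRm : Rm ≠ 0) (hRp : Rp ≠ 0) (hDm : Dm ≠ 0)
    (hDp : Dp ≠ 0) :
    (n ! : ℚ) ^ (2 * M + 1) * (Rm * Rp) ^ (b + 1 + 1) /
        ((Dm * Dp) ^ (2 * M + 2 + (b + 1 + 1)) * (n ! : ℚ) ^ (2 * (b + 1 + 1) * r)) *
      (Dp ^ 2 * ((Dm * Dp) ^ 2) ^ M *
          ((n ! : ℚ) ^ r * Dm ^ 2 * Dp * ((n ! : ℚ) ^ (2 * r) * Dm * Dp) ^ b) /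
        (((n ! : ℚ) ^ 2) ^ M * ((n ! : ℚ) * Rm * (Rm * Rp) ^ b))) *
      ((n ! : ℚ) ^ (3 * r) * (n ! : ℚ) * Dm * Dp / (Rm * Rp ^ 2)) = (n ! : ℚ) / Dm := by
  have hn : (n ! : ℚ) ≠ 0 := by positivity
  rw [div_mul_div_comm, div_mul_div_comm, div_eq_div_iff (by positivity) hDm]
  ring

/-- **The key pointwise identity**: off the zeros of `(1∓ε)_n (1∓ε)_{rn}` (so near `ε = 0`),
`gKR(ε) = ((−1)^{rn})^B (−1)^{nB'} · Σ_{k≤n} Σ_{u≤n−k} brickTerm(k,u)(ε)` (`B' = b+1 ≥ 1`, `r ≥ 1`).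
[cite: KrattenthalerRivoal2007, §12 proof of Proposition 6, (eq:briques)] -/
theorem gKR_eq_sum_brickTerm (n M b r : ℕ) (hr : 1 ≤ r) {ε : ℚ}
    (hDm : ∏ l ∈ range n, (1 - ε + (l : ℚ)) ≠ 0) (hDp : ∏ l ∈ range n, (1 + ε + (l : ℚ)) ≠ 0)
    (hRm : ∏ l ∈ range (r * n), (1 - ε + (l : ℚ)) ≠ 0) (hRp : ∏ l ∈ range (r * n), (1 + ε + (l : ℚ)) ≠ 0) :
    gKR n M (b + 1) r ε = ((-1 : ℚ) ^ (r * n)) ^ (b + 1 + 1) * (-1) ^ (n * (b + 1)) *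
      ∑ k ∈ range (n + 1), ∑ u ∈ range (n - k + 1), brickTerm n r M (b + 1) k u ε := by
  unfold gKR
  rw [sPolThree_eq_KR, mul_sum, mul_sum]
  refine sum_congr rfl fun k hk => ?_
  have hkn : k ≤ n := Nat.lt_succ_iff.mp (mem_range.mp hk)
  set Rm := ∏ l ∈ range (r * n), (1 - ε + (l : ℚ)) with hRmdef
  set Rp := ∏ l ∈ range (r * n), (1 + ε + (l : ℚ)) with hRpdef
  set Dm := ∏ l ∈ range n, (1 - ε + (l : ℚ)) with hDmdef
  set Dp := ∏ l ∈ range n, (1 + ε + (l : ℚ)) with hDpdef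
  have hn : (n ! : ℚ) ≠ 0 := by positivity
  have hEXv : normEX n r ε (b + 1) = (n ! : ℚ) * Rm * (Rm * Rp) ^ b := by
    simp only [normEX]; rw [← hRmdef, ← hRpdef]
  have hDXv : normDX n r ε (b + 1) = (n ! : ℚ) ^ r * Dm ^ 2 * Dp * ((n ! : ℚ) ^ (2 * r) * Dm * Dp) ^ b := by
    simp only [normDX]; rw [← hDmdef, ← hDpdef]
  have hEX : ((n ! : ℚ) ^ 2) ^ M * ((n ! : ℚ) * Rm * (Rm * Rp) ^ b) ≠ 0 := by
    have : Rm * Rp ≠ 0 := mul_ne_zero hRm hRp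
    positivity
  -- the inner dictionary, solved for `rawInner`
  have e1 : rawInner n r M (b + 1) k ε = Dp ^ 2 * ((Dm * Dp) ^ 2) ^ M *
      ((n ! : ℚ) ^ r * Dm ^ 2 * Dp * ((n ! : ℚ) ^ (2 * r) * Dm * Dp) ^ b) *
      ((k ! : ℚ) * innerFlat n r M (b + 1) k ε) / (((n ! : ℚ) ^ 2) ^ M * ((n ! : ℚ) * Rm * (Rm * Rp) ^ b)) := by
    rw [eq_div_iff hEX, ← inner_eq_flat, ← hEXv, ← hDXv]
    linear_combination rawInner_dictionary n r M (b + 1) k hkn hDp hDm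
  -- the top line, solved for `topRaw`
  have e3 : ∀ u ∈ range (n - k + 1), topRaw n r k u ε =
      (-1) ^ (k + (n - k - u)) * ((n ! : ℚ) ^ (3 * r) * (n ! : ℚ) * Dm * Dp) *
        (specialBrickR2 n r k (k + u) ε * pbBlockPlus n r 1 ε * specialBrickR1 n r (k + u) (k + u) ε *
          polyBrick (((r * n + (k + u) + 2 : ℕ) : ℤ)) (n - k - u) ε) / (Rm * Rp ^ 2) := fun u hu => by
    rw [eq_div_iff (mul_ne_zero hRm (pow_ne_zero _ hRp))]
    linear_combination top_brick_identity n r k u hr (by have := mem_range.mp hu; omega) ε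
  have hsc := assembly_scalar n r M b hRm hRp hDm hDp
  calc ((-1 : ℚ) ^ (r * n)) ^ (b + 1 + 1) * (-1) ^ (n * (b + 1)) *
        ((n ! : ℚ) ^ (2 * M + 1) * (Rm * Rp) ^ (b + 1 + 1) /
          ((Dm * Dp) ^ (2 * M + 2 + (b + 1 + 1)) * (n ! : ℚ) ^ (2 * (b + 1 + 1) * r))) *
        ((n.choose k : ℚ) * (∏ j ∈ range k, (ε - n + j)) * (∏ j ∈ range k, (((r * n : ℕ) : ℚ) + ε + 1 + j)) *
          rawInner n r M (b + 1) k ε * balFourFThreeKR ε n r k)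
      = ((-1 : ℚ) ^ (r * n)) ^ (b + 1 + 1) * (-1) ^ (n * (b + 1)) *
        ((n ! : ℚ) ^ (2 * M + 1) * (Rm * Rp) ^ (b + 1 + 1) /
          ((Dm * Dp) ^ (2 * M + 2 + (b + 1 + 1)) * (n ! : ℚ) ^ (2 * (b + 1 + 1) * r))) *
        (Dp ^ 2 * ((Dm * Dp) ^ 2) ^ M *
          ((n ! : ℚ) ^ r * Dm ^ 2 * Dp * ((n ! : ℚ) ^ (2 * r) * Dm * Dp) ^ b) /
          (((n ! : ℚ) ^ 2) ^ M * ((n ! : ℚ) * Rm * (Rm * Rp) ^ b))) * innerFlat n r M (b + 1) k ε *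
        ∑ u ∈ range (n - k + 1), topRaw n r k u ε := by
        rw [e1, topRaw_sum]; ring
    _ = ∑ u ∈ range (n - k + 1), ((-1 : ℚ) ^ (r * n)) ^ (b + 1 + 1) * (-1) ^ (n * (b + 1)) *
        ((n ! : ℚ) ^ (2 * M + 1) * (Rm * Rp) ^ (b + 1 + 1) /
          ((Dm * Dp) ^ (2 * M + 2 + (b + 1 + 1)) * (n ! : ℚ) ^ (2 * (b + 1 + 1) * r))) *
        (Dp ^ 2 * ((Dm * Dp) ^ 2) ^ M *
          ((n ! : ℚ) ^ r * Dm ^ 2 * Dp * ((n ! : ℚ) ^ (2 * r) * Dm * Dp) ^ b) /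
          (((n ! : ℚ) ^ 2) ^ M * ((n ! : ℚ) * Rm * (Rm * Rp) ^ b))) * innerFlat n r M (b + 1) k ε *
        topRaw n r k u ε := by rw [mul_sum]
    _ = ∑ u ∈ range (n - k + 1), ((-1 : ℚ) ^ (r * n)) ^ (b + 1 + 1) * (-1) ^ (n * (b + 1)) *
        brickTerm n r M (b + 1) k u ε := by
        refine sum_congr rfl fun u hu => ?_
        rw [e3 u hu, brickTerm, rbMinus, ← hDmdef]
        calc _ = ((-1 : ℚ) ^ (r * n)) ^ (b + 1 + 1) * (-1) ^ (n * (b + 1)) * ((-1) ^ (k + (n - k - u)) *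
              innerFlat n r M (b + 1) k ε *
              (specialBrickR2 n r k (k + u) ε * pbBlockPlus n r 1 ε * specialBrickR1 n r (k + u) (k + u) ε *
                polyBrick (((r * n + (k + u) + 2 : ℕ) : ℤ)) (n - k - u) ε)) *
            ((n ! : ℚ) ^ (2 * M + 1) * (Rm * Rp) ^ (b + 1 + 1) /
                ((Dm * Dp) ^ (2 * M + 2 + (b + 1 + 1)) * (n ! : ℚ) ^ (2 * (b + 1 + 1) * r)) *
              (Dp ^ 2 * ((Dm * Dp) ^ 2) ^ M *
                  ((n ! : ℚ) ^ r * Dm ^ 2 * Dp * ((n ! : ℚ) ^ (2 * r) * Dm * Dp) ^ b) /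
                (((n ! : ℚ) ^ 2) ^ M * ((n ! : ℚ) * Rm * (Rm * Rp) ^ b))) *
              ((n ! : ℚ) ^ (3 * r) * (n ! : ℚ) * Dm * Dp / (Rm * Rp ^ 2))) := by ring
          _ = _ := by rw [hsc]; ring
    _ = _ := by rw [← mul_sum]

/-- Near `ε = 0` nothing vanishes. [folklore] -/
private theorem prod_one_add_ne_zero {ε : ℚ} (h1 : ε < 1 / 2) (h2 : -(1 / 2) < ε) (m : ℕ) :
    (∏ l ∈ range m, (1 - ε + (l : ℚ))) ≠ 0 ∧ (∏ l ∈ range m, (1 + ε + (l : ℚ))) ≠ 0 := by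
  refine ⟨prod_ne_zero_iff.2 fun l _ => ?_, prod_ne_zero_iff.2 fun l _ => ?_⟩
  · have : (0 : ℚ) ≤ l := Nat.cast_nonneg l
    exact ne_of_gt (by linarith)
  · have : (0 : ℚ) ≤ l := Nat.cast_nonneg l
    exact ne_of_gt (by linarith)

/-- **Krattenthaler–Rivoal's Proposition 6, case `A = 2M+2` even, `B = b+2 ≥ 2`, `r ≥ 1`**, in the form
«`gKR = K S(ε)/ε` is `d_n`-integral to all orders at `ε = 0`»: for every `N`,
`IsDInt (d_n) N (gKR n M (b+1) r) 0`, i.e. `d_n^{j} 𝒟_j gKR(0) ∈ ℤ` for all `j ≤ N` — KR's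
`d_n^{h−1} K 𝒟_h S(0) ∈ ℤ` (`𝒟_h(ε·g) (0) = 𝒟_{h−1} g(0)`). Proof = the printed one: (eq:briques) (`gKR_eq_sum_brickTerm`:
Théorème 9 via Corollaire 3, the dictionary, both brick lines) and Lemmes 9–10 (`brickTerm_isDInt`).
[cite: KrattenthalerRivoal2007, §12 Proposition 6 (i) (arXiv:math/0311114 p. 29), case A even, B ≥ 2]
-- TODO(general form): B = 1 (via Corollaires 5/6), A odd (sPolFour / the confluent chain), r = 0. -/
theorem proposition6_evenA (n M b r : ℕ) (hr : 1 ≤ r) (N : ℕ) : IsDInt (Nat.lcmUpto n) N (gKR n M (b + 1) r) 0 := by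
  have hS : IsDInt (Nat.lcmUpto n) N (fun ε => ((-1 : ℚ) ^ (r * n)) ^ (b + 1 + 1) * (-1) ^ (n * (b + 1)) *
      ∑ k ∈ range (n + 1), ∑ u ∈ range (n - k + 1), brickTerm n r M (b + 1) k u ε) 0 := by
    have hc := IsDInt.const (Nat.lcmUpto n) N (((-1) ^ (r * n)) ^ (b + 1 + 1) * (-1) ^ (n * (b + 1))) 0
    have hs := IsDInt.sum (range (n + 1)) (F := fun k ε => ∑ u ∈ range (n - k + 1), brickTerm n r M (b + 1) k u ε)
      (d := Nat.lcmUpto n) (N := N) (x := 0) fun k hk =>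
        IsDInt.sum (range (n - k + 1)) (F := fun u ε => brickTerm n r M (b + 1) k u ε) (d := Nat.lcmUpto n)
          (N := N) (x := 0) fun u hu =>
            brickTerm_isDInt hr M (b + 1) (by have := mem_range.mp hk; have := mem_range.mp hu; omega) N
    exact (hc.mul hs).congr (Eventually.of_forall fun ε => by push_cast; ring)
  refine hS.congr ?_
  have h1 : ∀ᶠ ε in nhds (0 : ℚ), ε < 1 / 2 := eventually_lt_nhds (by norm_num)
  have h2 : ∀ᶠ ε in nhds (0 : ℚ), -(1 / 2) < ε := eventually_gt_nhds (by norm_num)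
  filter_upwards [h1, h2] with ε hε1 hε2
  have hn := prod_one_add_ne_zero hε1 hε2 n
  have hrn := prod_one_add_ne_zero hε1 hε2 (r * n)
  exact (gKR_eq_sum_brickTerm n M b r hr hn.1 hn.2 hrn.1 hrn.2).symm

/-! ### The case `B = 1` (`B' = 0`): Corollaire 5's chain — bottom pair `(x,x)`, no `∏_q R(n,0;qn+ε+1)` -/

/-- `∏_{q<r} R(n,0;qn+1+ε) · n!^r = (1+ε)_{rn}`. [cite: KrattenthalerRivoal2007, §12 (eq:briques)] -/
private theorem pbBlockPlus_one_mul (n r : ℕ) (ε : ℚ) :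
    pbBlockPlus n r 1 ε * (n ! : ℚ) ^ r = ∏ l ∈ range (r * n), (1 + ε + (l : ℚ)) := by
  have hblocks : ∀ (z : ℚ) (r' : ℕ), pw z (r' * n) = ∏ q ∈ range r', pw (z + q * n) n := by
    intro z r'
    induction r' with
    | zero => simp [pw]
    | succ r' ih =>
      rw [Nat.succ_mul, pw_add, ih, prod_range_succ]
      congr 1
      exact pw_congr (by push_cast; ring) n
  unfold pbBlockPlus polyBrick
  rw [prod_div_distrib, prod_const, card_range, div_mul_cancel₀ _ (by positivity), ← pw_def, hblocks]
  refine prod_congr rfl fun q _ => ?_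
  rw [← pw_def]
  exact pw_congr (by push_cast; ring) _

/-- The `(k,u)` summand for `B = 1`: `(−1)^{k+n−k−u} · (R(0,n+1;−ε)(−ε))² · innerFlat(k) · R₂(n,k,i;ε) · R₁(n,i,i;ε)
· R(n−i,0;rn+i+ε+2)` (`i = k+u`). [cite: KrattenthalerRivoal2007, §12 proof of Proposition 6 («Le cas B=1 … au moyen
des Corollaires 5 et 6»)] -/
def brickTermOne (n r M k u : ℕ) (ε : ℚ) : ℚ :=
  (-1) ^ (k + (n - k - u)) * rbMinus n ε ^ 2 * innerFlat n r M 0 k ε *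
    (specialBrickR2 n r k (k + u) ε * specialBrickR1 n r (k + u) (k + u) ε *
      polyBrick (((r * n + (k + u) + 2 : ℕ) : ℤ)) (n - k - u) ε)

/-- Every `brickTermOne` is `d_n`-integral to all orders at `ε = 0`. [cite: KrattenthalerRivoal2007, §11 Lemmes 9–10] -/
theorem brickTermOne_isDInt {n r : ℕ} (hr : 1 ≤ r) (M : ℕ) {k u : ℕ} (hku : k + u ≤ n) (N : ℕ) :
    IsDInt (Nat.lcmUpto n) N (brickTermOne n r M k u) 0 := by
  have h1 := IsDInt.const (Nat.lcmUpto n) N ((-1) ^ (k + (n - k - u))) 0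
  have h2 := (rbMinus_isDInt (n := n) (i := n) le_rfl N).pow 2
  have h3 := innerFlat_isDInt (n := n) (r := r) N M 0 k (by omega)
  have h4 := specialBrickR2_isDInt n r k (k + u) hr (by omega) hku N
  have h6 := specialBrickR1_isDInt n r (k + u) (k + u) hr hku N
  have h7 := polyBrick_eps_isDInt (((r * n + (k + u) + 2 : ℕ) : ℤ)) (show n - k - u ≤ n by omega) N
  exact (((h1.mul h2).mul h3).mul ((h4.mul h6).mul h7)).congr
    (Eventually.of_forall fun ε => by simp only [brickTermOne]; push_cast; ring)

/-- The normalisers for `B = 1` collapse to `(n!/(1−ε)_n)²` once `∏_q R(n,0;qn+ε+1) = (1+ε)_{rn}/n!^r` is used.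
[cite: KrattenthalerRivoal2007, §12 proof of Proposition 6] -/
private theorem assembly_scalar_one (n r M : ℕ) {Rm Rp Dm Dp : ℚ} (hRm : Rm ≠ 0) (hRp : Rp ≠ 0) (hDm : Dm ≠ 0)
    (hDp : Dp ≠ 0) :
    (n ! : ℚ) ^ (2 * M + 1) * (Rm * Rp) ^ (0 + 1) /
        ((Dm * Dp) ^ (2 * M + 2 + (0 + 1)) * (n ! : ℚ) ^ (2 * (0 + 1) * r)) *
      (Dp ^ 2 * ((Dm * Dp) ^ 2) ^ M / ((n ! : ℚ) ^ 2) ^ M) *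
      ((n ! : ℚ) ^ (3 * r) * (n ! : ℚ) * Dm * Dp / (Rm * Rp ^ 2)) * (Rp / (n ! : ℚ) ^ r) =
      ((n ! : ℚ) / Dm) ^ 2 := by
  have hn : (n ! : ℚ) ≠ 0 := by positivity
  rw [div_mul_div_comm, div_mul_div_comm, div_mul_div_comm, div_pow, div_eq_div_iff (by positivity) (pow_ne_zero _ hDm)]
  ring

/-- The pointwise identity for `B = 1`: near `ε = 0`, `gKR n M 0 r = ((−1)^{rn}) · Σ_k Σ_u brickTermOne(k,u)`.
[cite: KrattenthalerRivoal2007, §12 proof of Proposition 6; §10 Corollaire 5] -/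
theorem gKR_zero_eq_sum_brickTermOne (n M r : ℕ) (hr : 1 ≤ r) {ε : ℚ}
    (hDm : ∏ l ∈ range n, (1 - ε + (l : ℚ)) ≠ 0) (hDp : ∏ l ∈ range n, (1 + ε + (l : ℚ)) ≠ 0)
    (hRm : ∏ l ∈ range (r * n), (1 - ε + (l : ℚ)) ≠ 0) (hRp : ∏ l ∈ range (r * n), (1 + ε + (l : ℚ)) ≠ 0) :
    gKR n M 0 r ε = ((-1 : ℚ) ^ (r * n)) ^ (0 + 1) * (-1) ^ (n * 0) *
      ∑ k ∈ range (n + 1), ∑ u ∈ range (n - k + 1), brickTermOne n r M k u ε := by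
  unfold gKR
  rw [sPolThree_eq_KR, mul_sum, mul_sum]
  refine sum_congr rfl fun k hk => ?_
  have hkn : k ≤ n := Nat.lt_succ_iff.mp (mem_range.mp hk)
  set Rm := ∏ l ∈ range (r * n), (1 - ε + (l : ℚ)) with hRmdef
  set Rp := ∏ l ∈ range (r * n), (1 + ε + (l : ℚ)) with hRpdef
  set Dm := ∏ l ∈ range n, (1 - ε + (l : ℚ)) with hDmdef
  set Dp := ∏ l ∈ range n, (1 + ε + (l : ℚ)) with hDpdef
  have hn : (n ! : ℚ) ≠ 0 := by positivity
  have hT : ((n ! : ℚ) ^ 2) ^ M ≠ 0 := by positivity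
  have e1 : rawInner n r M 0 k ε = Dp ^ 2 * ((Dm * Dp) ^ 2) ^ M *
      ((k ! : ℚ) * innerFlat n r M 0 k ε) / (((n ! : ℚ) ^ 2) ^ M) := by
    rw [eq_div_iff hT, ← inner_eq_flat]
    have h := rawInner_dictionary n r M 0 k hkn hDp hDm
    simp only [normEX, normDX, mul_one] at h
    linear_combination h
  have e3 : ∀ u ∈ range (n - k + 1), topRaw n r k u ε =
      (-1) ^ (k + (n - k - u)) * ((n ! : ℚ) ^ (3 * r) * (n ! : ℚ) * Dm * Dp) *
        (specialBrickR2 n r k (k + u) ε * pbBlockPlus n r 1 ε * specialBrickR1 n r (k + u) (k + u) ε *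
          polyBrick (((r * n + (k + u) + 2 : ℕ) : ℤ)) (n - k - u) ε) / (Rm * Rp ^ 2) := fun u hu => by
    rw [eq_div_iff (mul_ne_zero hRm (pow_ne_zero _ hRp))]
    linear_combination top_brick_identity n r k u hr (by have := mem_range.mp hu; omega) ε
  have hpbB : pbBlockPlus n r 1 ε = Rp / (n ! : ℚ) ^ r := by
    rw [eq_div_iff (by positivity), hRpdef]; exact pbBlockPlus_one_mul n r ε
  have hsc := assembly_scalar_one n r M hRm hRp hDm hDp
  calc ((-1 : ℚ) ^ (r * n)) ^ (0 + 1) * (-1) ^ (n * 0) *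
        ((n ! : ℚ) ^ (2 * M + 1) * (Rm * Rp) ^ (0 + 1) /
          ((Dm * Dp) ^ (2 * M + 2 + (0 + 1)) * (n ! : ℚ) ^ (2 * (0 + 1) * r))) *
        ((n.choose k : ℚ) * (∏ j ∈ range k, (ε - n + j)) * (∏ j ∈ range k, (((r * n : ℕ) : ℚ) + ε + 1 + j)) *
          rawInner n r M 0 k ε * balFourFThreeKR ε n r k)
      = ((-1 : ℚ) ^ (r * n)) ^ (0 + 1) * (-1) ^ (n * 0) *
        ((n ! : ℚ) ^ (2 * M + 1) * (Rm * Rp) ^ (0 + 1) /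
          ((Dm * Dp) ^ (2 * M + 2 + (0 + 1)) * (n ! : ℚ) ^ (2 * (0 + 1) * r))) *
        (Dp ^ 2 * ((Dm * Dp) ^ 2) ^ M / ((n ! : ℚ) ^ 2) ^ M) * innerFlat n r M 0 k ε *
        ∑ u ∈ range (n - k + 1), topRaw n r k u ε := by
        rw [e1, topRaw_sum]; ring
    _ = ∑ u ∈ range (n - k + 1), ((-1 : ℚ) ^ (r * n)) ^ (0 + 1) * (-1) ^ (n * 0) *
        ((n ! : ℚ) ^ (2 * M + 1) * (Rm * Rp) ^ (0 + 1) /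
          ((Dm * Dp) ^ (2 * M + 2 + (0 + 1)) * (n ! : ℚ) ^ (2 * (0 + 1) * r))) *
        (Dp ^ 2 * ((Dm * Dp) ^ 2) ^ M / ((n ! : ℚ) ^ 2) ^ M) * innerFlat n r M 0 k ε *
        topRaw n r k u ε := by rw [mul_sum]
    _ = ∑ u ∈ range (n - k + 1), ((-1 : ℚ) ^ (r * n)) ^ (0 + 1) * (-1) ^ (n * 0) *
        brickTermOne n r M k u ε := by
        refine sum_congr rfl fun u hu => ?_
        rw [e3 u hu, brickTermOne, rbMinus, ← hDmdef, hpbB]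
        calc _ = ((-1 : ℚ) ^ (r * n)) ^ (0 + 1) * (-1) ^ (n * 0) * ((-1) ^ (k + (n - k - u)) *
              innerFlat n r M 0 k ε *
              (specialBrickR2 n r k (k + u) ε * specialBrickR1 n r (k + u) (k + u) ε *
                polyBrick (((r * n + (k + u) + 2 : ℕ) : ℤ)) (n - k - u) ε)) *
            ((n ! : ℚ) ^ (2 * M + 1) * (Rm * Rp) ^ (0 + 1) /
                ((Dm * Dp) ^ (2 * M + 2 + (0 + 1)) * (n ! : ℚ) ^ (2 * (0 + 1) * r)) *
              (Dp ^ 2 * ((Dm * Dp) ^ 2) ^ M / ((n ! : ℚ) ^ 2) ^ M) *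
              ((n ! : ℚ) ^ (3 * r) * (n ! : ℚ) * Dm * Dp / (Rm * Rp ^ 2)) * (Rp / (n ! : ℚ) ^ r)) := by ring
          _ = _ := by rw [hsc]; ring
    _ = _ := by rw [← mul_sum]

/-- **Krattenthaler–Rivoal's Proposition 6, case `A = 2M+2` even, `B = 1`, `r ≥ 1`**: for every `N`,
`IsDInt (d_n) N (gKR n M 0 r) 0`. [cite: KrattenthalerRivoal2007, §12 Proposition 6 (i), case A even, B = 1
(«au moyen des Corollaires 5 et 6»)] -/
theorem proposition6_evenA_one (n M r : ℕ) (hr : 1 ≤ r) (N : ℕ) : IsDInt (Nat.lcmUpto n) N (gKR n M 0 r) 0 := by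
  have hS : IsDInt (Nat.lcmUpto n) N (fun ε => ((-1 : ℚ) ^ (r * n)) ^ (0 + 1) * (-1) ^ (n * 0) *
      ∑ k ∈ range (n + 1), ∑ u ∈ range (n - k + 1), brickTermOne n r M k u ε) 0 := by
    have hc := IsDInt.const (Nat.lcmUpto n) N (((-1) ^ (r * n)) ^ (0 + 1) * (-1) ^ (n * 0)) 0
    have hs := IsDInt.sum (range (n + 1)) (F := fun k ε => ∑ u ∈ range (n - k + 1), brickTermOne n r M k u ε)
      (d := Nat.lcmUpto n) (N := N) (x := 0) fun k hk =>
        IsDInt.sum (range (n - k + 1)) (F := fun u ε => brickTermOne n r M k u ε) (d := Nat.lcmUpto n)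
          (N := N) (x := 0) fun u hu =>
            brickTermOne_isDInt hr M (by have := mem_range.mp hk; have := mem_range.mp hu; omega) N
    exact (hc.mul hs).congr (Eventually.of_forall fun ε => by push_cast; ring)
  refine hS.congr ?_
  have h1 : ∀ᶠ ε in nhds (0 : ℚ), ε < 1 / 2 := eventually_lt_nhds (by norm_num)
  have h2 : ∀ᶠ ε in nhds (0 : ℚ), -(1 / 2) < ε := eventually_gt_nhds (by norm_num)
  filter_upwards [h1, h2] with ε hε1 hε2
  have hn := prod_one_add_ne_zero hε1 hε2 n
  have hrn := prod_one_add_ne_zero hε1 hε2 (r * n)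
  exact (gKR_zero_eq_sum_brickTermOne n M r hr hn.1 hn.2 hrn.1 hrn.2).symm

/-- **Proposition 6 for every even `A ≥ 2`, every `B ≥ 1` and `r ≥ 1`** (the two cases together).
[cite: KrattenthalerRivoal2007, §12 Proposition 6 (i), A even] -/
theorem proposition6_even (n M B' r : ℕ) (hr : 1 ≤ r) (N : ℕ) : IsDInt (Nat.lcmUpto n) N (gKR n M B' r) 0 := by
  cases B' with
  | zero => exact proposition6_evenA_one n M r hr N
  | succ b => exact proposition6_evenA n M b r hr N

/-! ### The case `r = 0`: the top line degenerates

For `r = 0` (allowed in Proposition 6, and needed for Théorème 1 with `r = 0`, where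
`R_{n,A,B,0}(k) = n!^A (k+n/2)/(k)_{n+1}^A`) the top balanced `₄F₃` of the normal form has `σ = −rn = 0`: its factor
`(−rn)_{U−u} = (0)_{U−u}` kills every term with `u < U = n−k`, and the surviving term `u = n−k` is the polynomial
`(−1)^k · n!·C(n+1,k+1) · (1−ε)_n (1+ε)_n`; the special bricks `R₁`, `R₂` (Lemme 10, `r ≥ 1`) do not occur. Hence near
`ε = 0`, `gKR n M B' 0 = ± Σ_k (−1)^k C(n+1,k+1) · (R(0,n+1;−ε)(−ε))^{e} · innerFlat(k)` (`e = 1` for `B ≥ 2`, `e = 2`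
for `B = 1`), every term `d_n`-integral to all orders: Proposition 6 for `r = 0`. -/

/-- `pw 1 m = m!`. [folklore] -/
private theorem pw_one_eq_factorial (m : ℕ) : pw 1 m = (m ! : ℚ) := by
  rw [pw_def, ← Finset.prod_range_add_one_eq_factorial, Nat.cast_prod]
  exact prod_congr rfl fun i _ => by push_cast; ring

/-- For `r = 0` and `u < n−k` the top term vanishes (its factor `(−rn)_{n−k−u} = (0)_{n−k−u}` is `0`).
[cite: KrattenthalerRivoal2007, §12 proof of Proposition 6, (eq:briques) top line, case r = 0] -/
theorem topRaw_zero_r_of_lt (n k u : ℕ) (hu : u < n - k) (ε : ℚ) : topRaw n 0 k u ε = 0 := by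
  unfold topRaw
  have h0 : ∏ j ∈ range (n - k - u), (-((0 * n : ℕ) : ℚ) + j) = 0 :=
    prod_eq_zero (mem_range.2 (by omega) : 0 ∈ range (n - k - u)) (by simp)
  rw [h0]
  ring

/-- For `r = 0` the surviving top term `u = n−k` is `(−1)^k · n!·C(n+1,k+1) · (1−ε)_n (1+ε)_n`.
[cite: KrattenthalerRivoal2007, §12 proof of Proposition 6, (eq:briques) top line, case r = 0] -/
theorem topRaw_zero_r_top (n k : ℕ) (hk : k ≤ n) (ε : ℚ) :
    topRaw n 0 k (n - k) ε = (-1) ^ k * ((n ! : ℚ) * ((n + 1).choose (k + 1) : ℚ)) *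
      ((∏ l ∈ range n, (1 - ε + (l : ℚ))) * ∏ l ∈ range n, (1 + ε + (l : ℚ))) := by
  have e0 : topRaw n 0 k (n - k) ε = (n.choose k : ℚ) * pw (ε - n) k * pw (ε + 1) k * (k ! : ℚ) *
      (pw ((k : ℚ) + 2) (n - k) * pw ((k : ℚ) + 1 + ε) (n - k) * pw (1 - ε) (n - k)) := by
    unfold topRaw
    rw [Nat.sub_self, Nat.choose_self]
    simp only [range_zero, prod_empty, mul_one, Nat.cast_one, one_mul, Nat.zero_mul, Nat.cast_zero, zero_add, pw_def]
  -- `(ε−n)_k (1−ε)_{n−k} = (−1)^k (1−ε)_n`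
  have e1 : pw (ε - n) k * pw (1 - ε) (n - k) = (-1) ^ k * pw (1 - ε) n := by
    have h := pw_add (1 - ε) (n - k) k
    rw [Nat.sub_add_cancel hk] at h
    rw [h, show ε - (n : ℚ) = -((n : ℚ) - ε) by ring, pw_neg_rev,
      pw_congr (show (n : ℚ) - ε - k + 1 = 1 - ε + ((n - k : ℕ) : ℚ) by push_cast [Nat.cast_sub hk]; ring) k]
    ring
  -- `(1+ε)_k (k+1+ε)_{n−k} = (1+ε)_n`
  have e2 : pw (ε + 1) k * pw ((k : ℚ) + 1 + ε) (n - k) = pw (1 + ε) n := by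
    have h := pw_add (1 + ε) k (n - k)
    rw [Nat.add_sub_cancel' hk] at h
    rw [h, pw_congr (show ε + 1 = 1 + ε by ring) k, pw_congr (show (k : ℚ) + 1 + ε = 1 + ε + k by ring) (n - k)]
  -- `C(n,k) k! (k+2)_{n−k} = n! C(n+1,k+1)`
  have e3 : (n.choose k : ℚ) * (k ! : ℚ) * pw ((k : ℚ) + 2) (n - k) = (n ! : ℚ) * ((n + 1).choose (k + 1) : ℚ) := by
    have hP : pw ((k : ℚ) + 2) (n - k) * ((k + 1)! : ℚ) = ((n + 1)! : ℚ) := by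
      have h := pw_add 1 (k + 1) (n - k)
      rw [show k + 1 + (n - k) = n + 1 by omega, pw_one_eq_factorial, pw_one_eq_factorial,
        pw_congr (show (1 : ℚ) + ((k + 1 : ℕ) : ℚ) = (k : ℚ) + 2 by push_cast; ring) (n - k)] at h
      rw [h, mul_comm]
    have h1 : (n.choose k : ℚ) * (k ! : ℚ) * ((n - k)! : ℚ) = (n ! : ℚ) := by
      exact_mod_cast Nat.choose_mul_factorial_mul_factorial hk
    have h2 : ((n + 1).choose (k + 1) : ℚ) * ((k + 1)! : ℚ) * ((n - k)! : ℚ) = ((n + 1)! : ℚ) := by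
      have := Nat.choose_mul_factorial_mul_factorial (show k + 1 ≤ n + 1 by omega)
      rw [Nat.add_sub_add_right] at this
      exact_mod_cast this
    have hne : ((k + 1)! : ℚ) * ((n - k)! : ℚ) ≠ 0 := by positivity
    apply mul_right_cancel₀ hne
    linear_combination ((n.choose k : ℚ) * (k ! : ℚ) * ((n - k)! : ℚ)) * hP + ((n + 1)! : ℚ) * h1 - (n ! : ℚ) * h2
  rw [e0, ← pw_def, ← pw_def]
  calc (n.choose k : ℚ) * pw (ε - n) k * pw (ε + 1) k * (k ! : ℚ) *
        (pw ((k : ℚ) + 2) (n - k) * pw ((k : ℚ) + 1 + ε) (n - k) * pw (1 - ε) (n - k))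
      = ((n.choose k : ℚ) * (k ! : ℚ) * pw ((k : ℚ) + 2) (n - k)) * (pw (ε - n) k * pw (1 - ε) (n - k)) *
          (pw (ε + 1) k * pw ((k : ℚ) + 1 + ε) (n - k)) := by ring
    _ = _ := by rw [e1, e2, e3]; ring

/-- **(eq:briques) for `r = 0`, `B ≥ 2`**: off the zeros of `(1∓ε)_n`,
`gKR n M (b+1) 0 = (−1)^{n(b+1)} Σ_{k≤n} (−1)^k C(n+1,k+1) · R(0,n+1;−ε)(−ε) · innerFlat(k)`.
[cite: KrattenthalerRivoal2007, §12 proof of Proposition 6, (eq:briques), case r = 0] -/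
theorem gKR_zero_r_eq_sum (n M b : ℕ) {ε : ℚ}
    (hDm : ∏ l ∈ range n, (1 - ε + (l : ℚ)) ≠ 0) (hDp : ∏ l ∈ range n, (1 + ε + (l : ℚ)) ≠ 0) :
    gKR n M (b + 1) 0 ε = (-1) ^ (n * (b + 1)) *
      ∑ k ∈ range (n + 1), (-1) ^ k * ((n + 1).choose (k + 1) : ℚ) * (rbMinus n ε * innerFlat n 0 M (b + 1) k ε) := by
  unfold gKR
  rw [sPolThree_eq_KR, mul_sum, mul_sum]
  refine sum_congr rfl fun k hk => ?_
  have hkn : k ≤ n := Nat.lt_succ_iff.mp (mem_range.mp hk)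
  set Dm := ∏ l ∈ range n, (1 - ε + (l : ℚ)) with hDmdef
  set Dp := ∏ l ∈ range n, (1 + ε + (l : ℚ)) with hDpdef
  have hn : (n ! : ℚ) ≠ 0 := by positivity
  have hEX : ((n ! : ℚ) ^ 2) ^ M * (n ! : ℚ) ≠ 0 := by positivity
  have hEXv : normEX n 0 ε (b + 1) = (n ! : ℚ) := by simp [normEX]
  have hDXv : normDX n 0 ε (b + 1) = Dm ^ 2 * Dp * (Dm * Dp) ^ b := by
    simp only [normDX, Nat.mul_zero, pow_zero, one_mul, ← hDmdef, ← hDpdef]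
  -- the inner dictionary, solved for `rawInner`
  have e1 : rawInner n 0 M (b + 1) k ε = Dp ^ 2 * ((Dm * Dp) ^ 2) ^ M * (Dm ^ 2 * Dp * (Dm * Dp) ^ b) *
      ((k ! : ℚ) * innerFlat n 0 M (b + 1) k ε) / (((n ! : ℚ) ^ 2) ^ M * (n ! : ℚ)) := by
    rw [eq_div_iff hEX, ← inner_eq_flat, ← hDXv]
    have h := rawInner_dictionary n 0 M (b + 1) k hkn hDp hDm
    rw [hEXv] at h
    linear_combination h
  -- the top line: only `u = n−k` survives
  have e3 : ∑ u ∈ range (n - k + 1), topRaw n 0 k u ε =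
      (-1) ^ k * ((n ! : ℚ) * ((n + 1).choose (k + 1) : ℚ)) * (Dm * Dp) := by
    rw [sum_range_succ, sum_eq_zero fun u hu => topRaw_zero_r_of_lt n k u (mem_range.mp hu) ε, zero_add,
      topRaw_zero_r_top n k hkn ε]
  have e3' := topRaw_sum n 0 k ε
  rw [e3] at e3'
  -- assemble
  have hk0 : (k ! : ℚ) ≠ 0 := by positivity
  calc ((-1 : ℚ) ^ (0 * n)) ^ (b + 1 + 1) * (-1) ^ (n * (b + 1)) *
        ((n ! : ℚ) ^ (2 * M + 1) *
          ((∏ l ∈ range (0 * n), (1 - ε + (l : ℚ))) * ∏ l ∈ range (0 * n), (1 + ε + (l : ℚ))) ^ (b + 1 + 1) /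
          ((Dm * Dp) ^ (2 * M + 2 + (b + 1 + 1)) * (n ! : ℚ) ^ (2 * (b + 1 + 1) * 0))) *
        ((n.choose k : ℚ) * (∏ j ∈ range k, (ε - n + j)) * (∏ j ∈ range k, (((0 * n : ℕ) : ℚ) + ε + 1 + j)) *
          rawInner n 0 M (b + 1) k ε * balFourFThreeKR ε n 0 k)
      = (-1) ^ (n * (b + 1)) * ((n ! : ℚ) ^ (2 * M + 1) / (Dm * Dp) ^ (2 * M + 2 + (b + 1 + 1))) *
        (rawInner n 0 M (b + 1) k ε / (k ! : ℚ)) *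
        ((n.choose k : ℚ) * (∏ j ∈ range k, (ε - n + j)) * (∏ j ∈ range k, (((0 * n : ℕ) : ℚ) + ε + 1 + j)) *
          (k ! : ℚ) * balFourFThreeKR ε n 0 k) := by
        simp only [Nat.zero_mul, Nat.mul_zero, range_zero, prod_empty, pow_zero, one_pow, mul_one, one_mul]
        field_simp
    _ = (-1) ^ (n * (b + 1)) * ((n ! : ℚ) ^ (2 * M + 1) / (Dm * Dp) ^ (2 * M + 2 + (b + 1 + 1))) *
        (Dp ^ 2 * ((Dm * Dp) ^ 2) ^ M * (Dm ^ 2 * Dp * (Dm * Dp) ^ b) *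
          innerFlat n 0 M (b + 1) k ε / (((n ! : ℚ) ^ 2) ^ M * (n ! : ℚ))) *
        ((-1) ^ k * ((n ! : ℚ) * ((n + 1).choose (k + 1) : ℚ)) * (Dm * Dp)) := by
        rw [e3', e1]
        field_simp
    _ = (-1) ^ (n * (b + 1)) * ((-1) ^ k * ((n + 1).choose (k + 1) : ℚ) *
        (rbMinus n ε * innerFlat n 0 M (b + 1) k ε)) := by
        rw [rbMinus, ← hDmdef]
        field_simp
        ring

/-- **(eq:briques) for `r = 0`, `B = 1`**: off the zeros of `(1∓ε)_n`,
`gKR n M 0 0 = Σ_{k≤n} (−1)^k C(n+1,k+1) · (R(0,n+1;−ε)(−ε))² · innerFlat(k)` (the bottom pair is `(x,x)`).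
[cite: KrattenthalerRivoal2007, §12 proof of Proposition 6, case B = 1 («Corollaires 5 et 6»), r = 0] -/
theorem gKR_zero_r_one_eq_sum (n M : ℕ) {ε : ℚ}
    (hDm : ∏ l ∈ range n, (1 - ε + (l : ℚ)) ≠ 0) (hDp : ∏ l ∈ range n, (1 + ε + (l : ℚ)) ≠ 0) :
    gKR n M 0 0 ε =
      ∑ k ∈ range (n + 1), (-1) ^ k * ((n + 1).choose (k + 1) : ℚ) * (rbMinus n ε ^ 2 * innerFlat n 0 M 0 k ε) := by
  unfold gKR
  rw [sPolThree_eq_KR, mul_sum]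
  refine sum_congr rfl fun k hk => ?_
  have hkn : k ≤ n := Nat.lt_succ_iff.mp (mem_range.mp hk)
  set Dm := ∏ l ∈ range n, (1 - ε + (l : ℚ)) with hDmdef
  set Dp := ∏ l ∈ range n, (1 + ε + (l : ℚ)) with hDpdef
  have hn : (n ! : ℚ) ≠ 0 := by positivity
  have hEX : ((n ! : ℚ) ^ 2) ^ M ≠ 0 := by positivity
  -- the inner dictionary, solved for `rawInner`
  have e1 : rawInner n 0 M 0 k ε = Dp ^ 2 * ((Dm * Dp) ^ 2) ^ M *
      ((k ! : ℚ) * innerFlat n 0 M 0 k ε) / (((n ! : ℚ) ^ 2) ^ M) := by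
    rw [eq_div_iff hEX, ← inner_eq_flat]
    have h := rawInner_dictionary n 0 M 0 k hkn hDp hDm
    simp only [normEX, normDX, mul_one] at h
    linear_combination h
  -- the top line: only `u = n−k` survives
  have e3 : ∑ u ∈ range (n - k + 1), topRaw n 0 k u ε =
      (-1) ^ k * ((n ! : ℚ) * ((n + 1).choose (k + 1) : ℚ)) * (Dm * Dp) := by
    rw [sum_range_succ, sum_eq_zero fun u hu => topRaw_zero_r_of_lt n k u (mem_range.mp hu) ε, zero_add,
      topRaw_zero_r_top n k hkn ε]
  have e3' := topRaw_sum n 0 k ε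
  rw [e3] at e3'
  have hk0 : (k ! : ℚ) ≠ 0 := by positivity
  calc ((-1 : ℚ) ^ (0 * n)) ^ (0 + 1) * (-1) ^ (n * 0) *
        ((n ! : ℚ) ^ (2 * M + 1) *
          ((∏ l ∈ range (0 * n), (1 - ε + (l : ℚ))) * ∏ l ∈ range (0 * n), (1 + ε + (l : ℚ))) ^ (0 + 1) /
          ((Dm * Dp) ^ (2 * M + 2 + (0 + 1)) * (n ! : ℚ) ^ (2 * (0 + 1) * 0))) *
        ((n.choose k : ℚ) * (∏ j ∈ range k, (ε - n + j)) * (∏ j ∈ range k, (((0 * n : ℕ) : ℚ) + ε + 1 + j)) *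
          rawInner n 0 M 0 k ε * balFourFThreeKR ε n 0 k)
      = ((n ! : ℚ) ^ (2 * M + 1) / (Dm * Dp) ^ (2 * M + 2 + (0 + 1))) *
        (rawInner n 0 M 0 k ε / (k ! : ℚ)) *
        ((n.choose k : ℚ) * (∏ j ∈ range k, (ε - n + j)) * (∏ j ∈ range k, (((0 * n : ℕ) : ℚ) + ε + 1 + j)) *
          (k ! : ℚ) * balFourFThreeKR ε n 0 k) := by
        simp only [Nat.zero_mul, Nat.mul_zero, range_zero, prod_empty, pow_zero, one_pow, mul_one, one_mul]
        field_simp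
    _ = ((n ! : ℚ) ^ (2 * M + 1) / (Dm * Dp) ^ (2 * M + 2 + (0 + 1))) *
        (Dp ^ 2 * ((Dm * Dp) ^ 2) ^ M * innerFlat n 0 M 0 k ε / (((n ! : ℚ) ^ 2) ^ M)) *
        ((-1) ^ k * ((n ! : ℚ) * ((n + 1).choose (k + 1) : ℚ)) * (Dm * Dp)) := by
        rw [e3', e1]
        field_simp
    _ = (-1) ^ k * ((n + 1).choose (k + 1) : ℚ) * (rbMinus n ε ^ 2 * innerFlat n 0 M 0 k ε) := by
        rw [rbMinus, ← hDmdef]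
        field_simp
        ring

/-- **Krattenthaler–Rivoal's Proposition 6 for `A = 2M+2` even, any `B ≥ 1`, `r = 0`**: for every `N`,
`IsDInt (d_n) N (gKR n M B' 0) 0`. [cite: KrattenthalerRivoal2007, §12 Proposition 6 (i), case A even, r = 0] -/
theorem proposition6_even_zero_r (n M B' : ℕ) (N : ℕ) : IsDInt (Nat.lcmUpto n) N (gKR n M B' 0) 0 := by
  have h1 : ∀ᶠ ε in nhds (0 : ℚ), ε < 1 / 2 := eventually_lt_nhds (by norm_num)
  have h2 : ∀ᶠ ε in nhds (0 : ℚ), -(1 / 2) < ε := eventually_gt_nhds (by norm_num)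
  have hne : ∀ {ε : ℚ}, ε < 1 / 2 → -(1 / 2) < ε → ∀ m : ℕ,
      (∏ l ∈ range m, (1 - ε + (l : ℚ))) ≠ 0 ∧ (∏ l ∈ range m, (1 + ε + (l : ℚ))) ≠ 0 := by
    intro ε hε1 hε2 m
    refine ⟨prod_ne_zero_iff.2 fun l _ => ?_, prod_ne_zero_iff.2 fun l _ => ?_⟩
    · have : (0 : ℚ) ≤ l := Nat.cast_nonneg l
      exact ne_of_gt (by linarith)
    · have : (0 : ℚ) ≤ l := Nat.cast_nonneg l
      exact ne_of_gt (by linarith)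
  have hc : ∀ k : ℕ, IsDInt (Nat.lcmUpto n) N (fun _ : ℚ => (-1 : ℚ) ^ k * ((n + 1).choose (k + 1) : ℚ)) 0 := fun k =>
    (IsDInt.const (Nat.lcmUpto n) N ((-1) ^ k * ((n + 1).choose (k + 1) : ℤ)) 0).congr
      (Eventually.of_forall fun _ => by push_cast; ring)
  cases B' with
  | zero =>
    have hS : IsDInt (Nat.lcmUpto n) N (fun ε => ∑ k ∈ range (n + 1),
        (-1) ^ k * ((n + 1).choose (k + 1) : ℚ) * (rbMinus n ε ^ 2 * innerFlat n 0 M 0 k ε)) 0 :=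
      IsDInt.sum (range (n + 1)) (d := Nat.lcmUpto n) (N := N) (x := 0)
        (F := fun k ε => (-1) ^ k * ((n + 1).choose (k + 1) : ℚ) * (rbMinus n ε ^ 2 * innerFlat n 0 M 0 k ε))
        fun k hk => (hc k).mul (((rbMinus_isDInt (n := n) (i := n) le_rfl N).pow 2).mul
          (innerFlat_isDInt (n := n) (r := 0) N M 0 k (Nat.lt_succ_iff.mp (mem_range.mp hk))))
    refine hS.congr ?_
    filter_upwards [h1, h2] with ε hε1 hε2
    exact (gKR_zero_r_one_eq_sum n M (hne hε1 hε2 n).1 (hne hε1 hε2 n).2).symm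
  | succ b =>
    have hS : IsDInt (Nat.lcmUpto n) N (fun ε => (-1 : ℚ) ^ (n * (b + 1)) * ∑ k ∈ range (n + 1),
        (-1) ^ k * ((n + 1).choose (k + 1) : ℚ) * (rbMinus n ε * innerFlat n 0 M (b + 1) k ε)) 0 := by
      have hsgn := IsDInt.const (Nat.lcmUpto n) N ((-1) ^ (n * (b + 1))) 0
      have hs := IsDInt.sum (range (n + 1)) (d := Nat.lcmUpto n) (N := N) (x := 0)
        (F := fun k ε => (-1) ^ k * ((n + 1).choose (k + 1) : ℚ) * (rbMinus n ε * innerFlat n 0 M (b + 1) k ε))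
        fun k hk => (hc k).mul ((rbMinus_isDInt (n := n) (i := n) le_rfl N).mul
          (innerFlat_isDInt (n := n) (r := 0) N M (b + 1) k (Nat.lt_succ_iff.mp (mem_range.mp hk))))
      exact (hsgn.mul hs).congr (Eventually.of_forall fun ε => by push_cast; ring)
    refine hS.congr ?_
    filter_upwards [h1, h2] with ε hε1 hε2
    exact (gKR_zero_r_eq_sum n M b (hne hε1 hε2 n).1 (hne hε1 hε2 n).2).symm

/-- **Proposition 6 for every even `A ≥ 2`, every `B ≥ 1` and every `r ≥ 0`** (`proposition6_even` for `r ≥ 1`,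
`proposition6_even_zero_r` for `r = 0`): for every `N`, `IsDInt (d_n) N (gKR n M B' r) 0`.
[cite: KrattenthalerRivoal2007, §12 Proposition 6 (i), A even (arXiv:math/0311114 p. 29)] -/
theorem proposition6_even' (n M B' r : ℕ) (N : ℕ) : IsDInt (Nat.lcmUpto n) N (gKR n M B' r) 0 := by
  rcases Nat.eq_zero_or_pos r with rfl | hr
  · exact proposition6_even_zero_r n M B' N
  · exact proposition6_even n M B' r hr N

end Literature.NumberTheory.Irrationality.KrattenthalerRivoal2007
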